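import Summits.AtomisticToContinuum.HydrodynamicLimit.Theorems.BoxDissipativeWeakStrongRelativeEnergyStabilityCutEosMasterTransferHelpers
import Summits.AtomisticToContinuum.HydrodynamicLimit.Theorems.BoxDissipativeWeakStrongRelativeEnergyStabilityCutEosMasterHelpers
import Summits.AtomisticToContinuum.HydrodynamicLimit.Theorems.JParityClosureParityInBandBridge
import Summits.AtomisticToContinuum.HydrodynamicLimit.Theorems.JParityClosureParityInBandEos
import Literature.Analysis.FluidPDE.MVIdentitiesAveraged
import Literature.MathematicalPhysics.KineticTheory.HardSphereEulerLocalTheoryProofs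
import HarnessLib

/-!
# Crux `RelativeEnergyStability` (stmt-AtomisticToContinuum-17653), line `registered`, heart stub S-X — part 2:
# the strong solution read through the cut law and its smooth band extension

For a classical hard-sphere Euler solution `(ρ,u,θ)` on `[0,T)` obeying the guard `ρσ³ ≤ η₁/2`, a band `η₁` below
the (σ-uniform) band edge `η₁B` of the smooth extension `eosB = EulerEOS.monatomicExcess χ f` of the hard-sphere law
(`cm_band_extension`), this file provides what the Březina–Feireisl bookkeeping needs of the STRONG side:

* the solution is classical for `eosB` and for `cutEOS σ η₁` (`sx_sol_B`, `sx_sol_cut`);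
* at every point datum `d = pdAt T ρ u θ (t,x)`: `p, s, pρ, pϑ, μ, φ₁t, gφ₁, pt, gp, divPU` of the cut law equal those of
  `eosB` (`sx_pd_*`), hence `d.MomentumEq (cutEOS σ η₁)` and `d.TemperatureEq (cutEOS σ η₁)` (`sx_pd_eqs`);
* BF's energy test function `φ₁ = ½|u|² − μ_cut(ρ,θ)` is JOINTLY SMOOTH on `[0,T) × 𝕋³` (the cut law is the analytic
  hard-sphere law along the solution; `sx_energyTest_smooth`) with `∂ₜφ₁ = d.φ₁t`, `∇φ₁ = d.gφ₁` (`sx_energyTest_derivs`);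
* `∫ (p_cut divU + U·∇p_cut)(t,·) dx = 0` (`sx_div_zero`) and the pressure FTC in iterated form (`sx_pressure_ftc`).
-/

noncomputable section

namespace Summit.AtomisticToContinuum.HydrodynamicLimit.Theorems.RES

open MeasureTheory Filter Set Metric Function
open scoped Topology ContDiff
open Summit.AtomisticToContinuum.HydrodynamicLimit.Theses.BoxDissipativeWeakStrong
open Literature.MathematicalPhysics.KineticTheory Literature.Analysis.FluidPDE Literature.Analysis.FunctionSpaces
open Literature.Analysis.FluidPDE.CompressibleEuler
open Literature.Analysis.FluidPDE.CompressibleEuler.StrongPointData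

section Strong

variable {η₀ η₁ η₁B σ T : ℝ} {F χ f : ℝ → ℝ} {ρ θ : ℝ → T3 → ℝ} {u : ℝ → T3 → V3}

/-! The standing hypotheses of the strong side (a conjunction `S`, destructured by projections): the EOS fact data
`(η₀, F)`; a band `η₁` below the band edge `η₁B < η₀/2` of a smooth extension `(χ, f)` of the hard-sphere law at reduced
diameter `σ` (agreeing with it for `ρσ³ ≤ η₁B`, Gibbs); a classical hard-sphere Euler solution on `[0,T)` with the guard
`ρσ³ ≤ η₁/2`. Components: `S.1 = hF`, `S.2.1 = hEq`, `S.2.2.1 : 0 < η₁`, `S.2.2.2.1 : η₁ ≤ η₁B`, `S.2.2.2.2.1 : 2η₁B < η₀`,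
`S.2.2.2.2.2.1 : 0 < σ`, `S.2.2.2.2.2.2.1 = hagree`, `S.2.2.2.2.2.2.2.1 = hGB`, `S.2.2.2.2.2.2.2.2.1 = hsol`,
`S.2.2.2.2.2.2.2.2.2 = hguard`. -/

variable (S : AnalyticOnNhd ℝ F (Ioo (-η₀) η₀) ∧ EqOn hsExcessFreeEnergy F (Ico 0 η₀) ∧ 0 < η₁ ∧ η₁ ≤ η₁B ∧
  2 * η₁B < η₀ ∧ 0 < σ ∧
  (∀ x, 0 < x → x * σ ^ 3 ≤ η₁B → f x = hsExcessFreeEnergy (x * σ ^ 3) ∧ χ x = hsCompressibility (x * σ ^ 3)) ∧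
  (EulerEOS.monatomicExcess χ f).IsGibbs ∧ IsHardSphereEulerSolution σ T ρ u θ ∧
  ∀ t ∈ Ico 0 T, ∀ x, ρ t x * σ ^ 3 ≤ η₁ / 2)
include S

/-- The band lies inside the analyticity interval: `η₁ < η₀`. -/
theorem sx_band_lt : η₁ < η₀ := by
  have := S.2.2.2.1; have := S.2.2.2.2.1; have := S.2.2.1; linarith

/-- Along the solution the reduced density is in the band interior: `ρσ³ ≤ η₁/2 < η₁`. -/
theorem sx_band {t : ℝ} (ht : t ∈ Ico 0 T) (x : T3) :
    0 < ρ t x ∧ ρ t x * σ ^ 3 < η₁ ∧ 0 < θ t x :=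
  ⟨S.2.2.2.2.2.2.2.2.1.density_pos t ht x, by have := S.2.2.2.2.2.2.2.2.2 t ht x; have := S.2.2.1; linarith,
    S.2.2.2.2.2.2.2.2.1.temperature_pos t ht x⟩

/-- In the band interior the cut compressibility, the hard-sphere compressibility and `χ` agree NEAR a point. -/
theorem sx_chi_eventuallyEq {r : ℝ} (hr : 0 < r) (hrb : r * σ ^ 3 < η₁) :
    (fun x => cutCompressibility η₁ (x * σ ^ 3)) =ᶠ[𝓝 r] χ := by
  have hσ3 : 0 < σ ^ 3 := pow_pos S.2.2.2.2.2.1 3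
  have hcont : ContinuousAt (fun x : ℝ => x * σ ^ 3) r := (continuous_id.mul continuous_const).continuousAt
  have h1 : ∀ᶠ x in 𝓝 r, 0 < x := Ioi_mem_nhds hr
  have h2 : ∀ᶠ x in 𝓝 r, x * σ ^ 3 < η₁ := hcont.preimage_mem_nhds (Iio_mem_nhds hrb)
  filter_upwards [h1, h2] with x hx hxb
  rw [cm_cutZ_of_le hxb.le, (S.2.2.2.2.2.2.1 x hx (hxb.le.trans S.2.2.2.1)).2]

/-- Values at a band-interior state: `χ`, `f` are the hard-sphere functions, equal to the cut ones. -/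
theorem sx_agree_at {r : ℝ} (hr : 0 < r) (hrb : r * σ ^ 3 < η₁) :
    cutCompressibility η₁ (r * σ ^ 3) = χ r ∧ cutExcessFreeEnergy η₁ (r * σ ^ 3) = f r := by
  obtain ⟨hf, hχ⟩ := S.2.2.2.2.2.2.1 r hr (hrb.le.trans S.2.2.2.1)
  exact ⟨by rw [cm_cutZ_of_le hrb.le, hχ], by rw [cm_cutF_of_le S.2.2.1 hrb.le, hf]⟩

/-- The solution is classical for the smooth band extension `eosB`. -/
theorem sx_sol_B : IsClassicalEulerSolution (EulerEOS.monatomicExcess χ f) T ρ u θ := by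
  refine isClassicalEulerSolution_of_isHardSphereEulerSolution_of_eqOn S.2.2.2.2.2.2.2.2.1
    (S := {q : ℝ × ℝ | 0 < q.1 ∧ q.1 * σ ^ 3 < η₁}) (fun t ht x => ⟨((sx_band S) ht x).1, ((sx_band S) ht x).2.1⟩)
    (fun q hq => ?_) (fun q _ => rfl)
  show q.1 * q.2 * χ q.1 = q.1 * q.2 * hsCompressibility (q.1 * σ ^ 3)
  rw [(S.2.2.2.2.2.2.1 q.1 hq.1 (hq.2.le.trans S.2.2.2.1)).2]

/-- The solution is classical for the cut law. -/
theorem sx_sol_cut : IsClassicalEulerSolution (cutEOS σ η₁) T ρ u θ := by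
  refine isClassicalEulerSolution_of_isHardSphereEulerSolution_of_eqOn S.2.2.2.2.2.2.2.2.1
    (S := {q : ℝ × ℝ | 0 < q.1 ∧ q.1 * σ ^ 3 < η₁}) (fun t ht x => ⟨((sx_band S) ht x).1, ((sx_band S) ht x).2.1⟩)
    (fun q hq => ?_) (fun q _ => rfl)
  show q.1 * q.2 * cutCompressibility η₁ (q.1 * σ ^ 3) = q.1 * q.2 * hsCompressibility (q.1 * σ ^ 3)
  rw [cm_cutZ_of_le hq.2.le]

/-- **Transfer at a point datum.** At `d = pdAt T ρ u θ (t,x)`, `t ∈ [0,T)`: the cut law and `eosB` have the same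
`p, s, pρ, pϑ` at the reference state, hence the same `μ`, `φ₁t`, `gφ₁`, `pt`, `gp`. -/
theorem sx_pd_transfer {t : ℝ} (ht : t ∈ Ico 0 T) (x : T3) :
    (cutEOS σ η₁).p (pdAt T ρ u θ (t, x)).r (pdAt T ρ u θ (t, x)).Θ =
        (EulerEOS.monatomicExcess χ f).p (pdAt T ρ u θ (t, x)).r (pdAt T ρ u θ (t, x)).Θ ∧
      (cutEOS σ η₁).s (pdAt T ρ u θ (t, x)).r (pdAt T ρ u θ (t, x)).Θ =
        (EulerEOS.monatomicExcess χ f).s (pdAt T ρ u θ (t, x)).r (pdAt T ρ u θ (t, x)).Θ ∧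
      (pdAt T ρ u θ (t, x)).pρ (cutEOS σ η₁) = (pdAt T ρ u θ (t, x)).pρ (EulerEOS.monatomicExcess χ f) ∧
      (pdAt T ρ u θ (t, x)).pϑ (cutEOS σ η₁) = (pdAt T ρ u θ (t, x)).pϑ (EulerEOS.monatomicExcess χ f) ∧
      (cutEOS σ η₁).chemPotential (pdAt T ρ u θ (t, x)).r (pdAt T ρ u θ (t, x)).Θ =
        (EulerEOS.monatomicExcess χ f).chemPotential (pdAt T ρ u θ (t, x)).r (pdAt T ρ u θ (t, x)).Θ ∧
      (pdAt T ρ u θ (t, x)).φ₁t (cutEOS σ η₁) = (pdAt T ρ u θ (t, x)).φ₁t (EulerEOS.monatomicExcess χ f) ∧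
      (∀ j, (pdAt T ρ u θ (t, x)).gφ₁ (cutEOS σ η₁) j =
        (pdAt T ρ u θ (t, x)).gφ₁ (EulerEOS.monatomicExcess χ f) j) ∧
      (pdAt T ρ u θ (t, x)).pt (cutEOS σ η₁) = (pdAt T ρ u θ (t, x)).pt (EulerEOS.monatomicExcess χ f) ∧
      (∀ j, (pdAt T ρ u θ (t, x)).gp (cutEOS σ η₁) j = (pdAt T ρ u θ (t, x)).gp (EulerEOS.monatomicExcess χ f) j) := by
  obtain ⟨hr, hrb, -⟩ := (sx_band S) ht x
  obtain ⟨hχr, hfr⟩ := (sx_agree_at S) hr hrb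
  obtain ⟨hp, hs, hpρ, hpϑ⟩ := cm_ref_transfer (d := pdAt T ρ u θ (t, x)) ((sx_chi_eventuallyEq S) hr hrb) hχr hfr
  have hμ : (cutEOS σ η₁).chemPotential (pdAt T ρ u θ (t, x)).r (pdAt T ρ u θ (t, x)).Θ =
      (EulerEOS.monatomicExcess χ f).chemPotential (pdAt T ρ u θ (t, x)).r (pdAt T ρ u θ (t, x)).Θ := by
    simp only [EulerEOS.chemPotential, hp, hs]; rfl
  refine ⟨hp, hs, hpρ, hpϑ, hμ, ?_, ?_, ?_, ?_⟩
  · simp only [StrongPointData.φ₁t, StrongPointData.μρ, StrongPointData.μϑ, hpρ, hpϑ, hs]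
  · intro j; simp only [StrongPointData.gφ₁, StrongPointData.μρ, StrongPointData.μϑ, hpρ, hpϑ, hs]
  · simp only [StrongPointData.pt, hpρ, hpϑ]
  · intro j; simp only [StrongPointData.gp, hpρ, hpϑ]

/-- **The three pointwise equations of the strong solution for the cut law** at `d = pdAt T ρ u θ (t,x)`. -/
theorem sx_pd_eqs {t : ℝ} (ht : t ∈ Ico 0 T) (x : T3) :
    (pdAt T ρ u θ (t, x)).MassEq ∧ (pdAt T ρ u θ (t, x)).MomentumEq (cutEOS σ η₁) ∧
      (pdAt T ρ u θ (t, x)).TemperatureEq (cutEOS σ η₁) := by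
  obtain ⟨hr, hrb, -⟩ := (sx_band S) ht x
  obtain ⟨hχr, -⟩ := (sx_agree_at S) hr hrb
  refine ⟨(sx_sol_B S).massEq_pointData ht x, ?_, ?_⟩
  · intro i
    have h := (sx_sol_B S).momentumEq_pointData S.2.2.2.2.2.2.2.1 ht x i
    obtain ⟨-, -, -, -, -, -, -, -, hgp⟩ := (sx_pd_transfer S) ht x
    rw [hgp i]; exact h
  · exact (cm_temperatureEq_iff (f₁ := fun r => cutExcessFreeEnergy η₁ (r * σ ^ 3)) (f₂ := f)
      (d := pdAt T ρ u θ (t, x)) hχr).2 ((sx_sol_B S).temperatureEq_pointData S.2.2.2.2.2.2.2.1 ht x)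

/-- The energy test functions of the cut law and of `eosB` coincide on `[0,T) × 𝕋³`. -/
theorem sx_energyTest_eq {t : ℝ} (ht : t ∈ Ico 0 T) (x : T3) :
    energyTestFunction (cutEOS σ η₁) ρ u θ t x = energyTestFunction (EulerEOS.monatomicExcess χ f) ρ u θ t x := by
  obtain ⟨-, -, -, -, hμ, -⟩ := (sx_pd_transfer S) ht x
  simp only [energyTestFunction]
  exact congrArg _ hμ

/-- `∂ₜφ₁ = d.φ₁t` and `∇φ₁ = d.gφ₁` for the cut energy test function. -/
theorem sx_energyTest_derivs {t : ℝ} (ht : t ∈ Ico 0 T) (x : T3) :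
    Torus.timeDerivWithin (Ico 0 T) (energyTestFunction (cutEOS σ η₁) ρ u θ) t x =
        (pdAt T ρ u θ (t, x)).φ₁t (cutEOS σ η₁) ∧
      ∀ j, Torus.gradient (energyTestFunction (cutEOS σ η₁) ρ u θ t) x j =
        (pdAt T ρ u θ (t, x)).gφ₁ (cutEOS σ η₁) j := by
  obtain ⟨-, -, -, -, -, hφ₁t, hgφ₁, -⟩ := (sx_pd_transfer S) ht x
  constructor
  · rw [hφ₁t, ← (sx_sol_B S).timeDerivWithin_energyTestFunction S.2.2.2.2.2.2.2.1 ht x]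
    unfold Torus.timeDerivWithin
    refine derivWithin_congr (fun s hs => (sx_energyTest_eq S) hs x) ((sx_energyTest_eq S) ht x)
  · intro j
    rw [hgφ₁ j, ← (sx_sol_B S).gradient_energyTestFunction S.2.2.2.2.2.2.2.1 ht x j]
    have : energyTestFunction (cutEOS σ η₁) ρ u θ t = energyTestFunction (EulerEOS.monatomicExcess χ f) ρ u θ t :=
      funext fun y => (sx_energyTest_eq S) ht y
    rw [this]


/-- The analytic chemical potential of the hard-sphere law in the band: `μ(r,Θ) = 3Θ/2 − Θ(3/2 log Θ − log r −
F(rσ³)) + Θ(1 + rσ³ F'(rσ³))`, as a function of `q = (r, Θ)`. (A local abbreviation, used only to prove smoothness.) -/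
theorem sx_chemPotential_eq_analytic {r Θ : ℝ} (hr : 0 < r) (hrb : r * σ ^ 3 < η₁) :
    (cutEOS σ η₁).chemPotential r Θ =
      3 / 2 * Θ - Θ * (3 / 2 * Real.log Θ - Real.log r - F (r * σ ^ 3)) +
        Θ * (1 + r * σ ^ 3 * deriv F (r * σ ^ 3)) := by
  have hσ3 : 0 < σ ^ 3 := pow_pos S.2.2.2.2.2.1 3
  have hη : r * σ ^ 3 ∈ Ioo 0 η₀ := ⟨mul_pos hr hσ3, hrb.trans (sx_band_lt S)⟩
  have hF : cutExcessFreeEnergy η₁ (r * σ ^ 3) = F (r * σ ^ 3) :=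
    cm_cutF_eq_F S.2.1 S.2.2.1 (sx_band_lt S) hη.1.le hrb.le
  have hZ : cutCompressibility η₁ (r * σ ^ 3) = 1 + r * σ ^ 3 * deriv F (r * σ ^ 3) := by
    rw [cm_cutZ_of_le hrb.le, hsCompressibility_eq S.2.1 hη]
  simp only [EulerEOS.chemPotential, cutEOS, EulerEOS.monatomicExcess, hF, hZ]
  field_simp

/-- **BF's energy test function of the cut law is jointly smooth on `[0,T) × 𝕋³`** (along the solution the cut law is the
analytic hard-sphere law). -/
theorem sx_energyTest_smooth :
    Torus.IsSmoothSpaceTimeOn (Ico 0 T) (energyTestFunction (cutEOS σ η₁) ρ u θ) := by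
  have hσ3 : 0 < σ ^ 3 := pow_pos S.2.2.2.2.2.1 3
  -- the open state domain and the analytic chemical potential on it
  set Us : Set (ℝ × ℝ) := {q | 0 < q.1 ∧ q.1 * σ ^ 3 < η₁ ∧ 0 < q.2} with hUs
  have hUo : IsOpen Us := by
    refine (isOpen_lt continuous_const continuous_fst).inter
      ((isOpen_lt (continuous_fst.mul continuous_const) continuous_const).inter
        (isOpen_lt continuous_const continuous_snd))
  set μa : ℝ × ℝ → ℝ := fun q => 3 / 2 * q.2 - q.2 * (3 / 2 * Real.log q.2 - Real.log q.1 - F (q.1 * σ ^ 3)) +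
    q.2 * (1 + q.1 * σ ^ 3 * deriv F (q.1 * σ ^ 3)) with hμa
  have hscale : ContDiff ℝ ∞ (fun q : ℝ × ℝ => q.1 * σ ^ 3) := contDiff_fst.mul contDiff_const
  have hη₀ : 0 < η₀ := S.2.2.1.trans (sx_band_lt S)
  have hmaps : MapsTo (fun q : ℝ × ℝ => q.1 * σ ^ 3) Us (Ioo (-η₀) η₀) := fun q hq =>
    ⟨show -η₀ < q.1 * σ ^ 3 by have := mul_pos hq.1 hσ3; linarith, hq.2.1.trans (sx_band_lt S)⟩
  have hFc : ContDiffOn ℝ ∞ F (Ioo (-η₀) η₀) := S.1.contDiffOn_of_completeSpace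
  have hF'c : ContDiffOn ℝ ∞ (deriv F) (Ioo (-η₀) η₀) := S.1.deriv.contDiffOn_of_completeSpace
  have h1 : MapsTo (fun q : ℝ × ℝ => q.1) Us {0}ᶜ := fun q hq => ne_of_gt hq.1
  have h2 : MapsTo (fun q : ℝ × ℝ => q.2) Us {0}ᶜ := fun q hq => ne_of_gt hq.2.2
  have hμc : ContDiffOn ℝ ∞ μa Us := by
    have hl1 : ContDiffOn ℝ ∞ (fun q : ℝ × ℝ => Real.log q.1) Us := Real.contDiffOn_log.comp contDiffOn_fst h1
    have hl2 : ContDiffOn ℝ ∞ (fun q : ℝ × ℝ => Real.log q.2) Us := Real.contDiffOn_log.comp contDiffOn_snd h2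
    have hFq : ContDiffOn ℝ ∞ (fun q : ℝ × ℝ => F (q.1 * σ ^ 3)) Us := hFc.comp hscale.contDiffOn hmaps
    have hF'q : ContDiffOn ℝ ∞ (fun q : ℝ × ℝ => deriv F (q.1 * σ ^ 3)) Us := hF'c.comp hscale.contDiffOn hmaps
    simp only [hμa]
    exact ((contDiffOn_const.mul contDiffOn_snd).sub
      (contDiffOn_snd.mul (((contDiffOn_const.mul hl2).sub hl1).sub hFq))).add
      (contDiffOn_snd.mul (contDiffOn_const.add (hscale.contDiffOn.mul hF'q)))
  -- `G(q, U) = ½‖U‖² − μa q` on `Us × V3`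
  set G : (ℝ × ℝ) × V3 → ℝ := fun w => ‖w.2‖ ^ 2 / 2 - μa w.1 with hG
  have hGc : ContDiffOn ℝ ∞ G (Us ×ˢ univ) := by
    have hn : ContDiff ℝ ∞ (fun w : (ℝ × ℝ) × V3 => ‖w.2‖ ^ 2 / 2) :=
      (contDiff_snd.norm_sq ℝ).div_const 2
    exact hn.contDiffOn.sub (hμc.comp contDiffOn_fst fun w hw => hw.1)
  -- the lift of the solution
  set L : ℝ × EuclideanSpace ℝ (Fin 3) → (ℝ × ℝ) × V3 := fun p =>
    ((Torus.stLift ρ p, Torus.stLift θ p), Torus.stLift u p) with hL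
  have hLc : ContDiffOn ℝ ∞ L (Ico 0 T ×ˢ univ) :=
    (S.2.2.2.2.2.2.2.2.1.smooth_density.prodMk S.2.2.2.2.2.2.2.2.1.smooth_temperature).prodMk S.2.2.2.2.2.2.2.2.1.smooth_velocity
  have hLmaps : MapsTo L (Ico 0 T ×ˢ univ) (Us ×ˢ univ) := by
    intro p hp
    refine ⟨?_, mem_univ _⟩
    obtain ⟨hr, hrb, hΘ⟩ := sx_band S hp.1 (Torus.proj p.2)
    exact ⟨hr, hrb, hΘ⟩
  have hcomp : ContDiffOn ℝ ∞ (G ∘ L) (Ico 0 T ×ˢ univ) := hGc.comp hLc hLmaps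
  refine hcomp.congr fun p hp => ?_
  obtain ⟨hr, hrb, -⟩ := sx_band S hp.1 (Torus.proj p.2)
  simp only [Torus.stLift, energyTestFunction, Function.comp, hG, hL, hμa]
  rw [(sx_chemPotential_eq_analytic S) hr hrb]

/-- `∫ (p_cut divU + U·∇p_cut)(t,·) dx = 0` at every `t ∈ [0,T)`. -/
theorem sx_div_zero {t : ℝ} (ht : t ∈ Ico 0 T) :
    ∫ x, ((cutEOS σ η₁).p (pdAt T ρ u θ (t, x)).r (pdAt T ρ u θ (t, x)).Θ * (pdAt T ρ u θ (t, x)).divU +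
      ∑ j, (pdAt T ρ u θ (t, x)).U j * (pdAt T ρ u θ (t, x)).gp (cutEOS σ η₁) j) = 0 := by
  obtain ⟨hdiv, hzero⟩ := (sx_sol_B S).div_pressure_flux S.2.2.2.2.2.2.2.1 ht
  rw [← hzero]
  refine integral_congr_ae (Eventually.of_forall fun x => ?_)
  obtain ⟨hp, -, -, -, -, -, -, -, hgp⟩ := (sx_pd_transfer S) ht x
  show (cutEOS σ η₁).p (pdAt T ρ u θ (t, x)).r (pdAt T ρ u θ (t, x)).Θ * (pdAt T ρ u θ (t, x)).divU +
      ∑ j, (pdAt T ρ u θ (t, x)).U j * (pdAt T ρ u θ (t, x)).gp (cutEOS σ η₁) j = _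
  rw [hdiv x, hp]
  simp only [hgp]
  rfl

/-- **Pressure FTC, iterated form**: `∫ p_cut(τ) − ∫ p_cut(0) = ∫_{(0,τ]} ∫ ∂ₜp_cut dx dt` for `τ ∈ [0,T)`. -/
theorem sx_pressure_ftc {τ : ℝ} (hτ : τ ∈ Ico 0 T) {Np : ℝ}
    (hN : ∀ t ∈ Icc 0 τ, ∀ x, |(pdAt T ρ u θ (t, x)).pt (cutEOS σ η₁)| ≤ Np) :
    (∫ x, (cutEOS σ η₁).p (ρ τ x) (θ τ x)) - (∫ x, (cutEOS σ η₁).p (ρ 0 x) (θ 0 x)) =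
      ∫ t in Ioc 0 τ, ∫ x, (pdAt T ρ u θ (t, x)).pt (cutEOS σ η₁) := by
  rcases eq_or_lt_of_le hτ.1 with h0 | hτ0
  · subst h0; simp
  have hsub : Icc (0:ℝ) τ ⊆ Ico 0 T := fun t ht => ⟨ht.1, ht.2.trans_lt hτ.2⟩
  -- transfer to `eosB`
  have hpB : ∀ t ∈ Ico 0 T, ∀ x, (cutEOS σ η₁).p (ρ t x) (θ t x) =
      (EulerEOS.monatomicExcess χ f).p (ρ t x) (θ t x) := fun t ht x => ((sx_pd_transfer S) ht x).1
  have hptB : ∀ t ∈ Ico 0 T, ∀ x, (pdAt T ρ u θ (t, x)).pt (cutEOS σ η₁) =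
      (pdAt T ρ u θ (t, x)).pt (EulerEOS.monatomicExcess χ f) := fun t ht x => ((sx_pd_transfer S) ht x).2.2.2.2.2.2.2.1
  have hN' : ∀ t ∈ Icc 0 τ, ∀ x, |(pdAt T ρ u θ (t, x)).pt (EulerEOS.monatomicExcess χ f)| ≤ Np :=
    fun t ht x => by rw [← hptB t (hsub ht) x]; exact hN t ht x
  have h := CompressibleEuler.pressure_ftc (sx_sol_B S) S.2.2.2.2.2.2.2.1 ⟨hτ0, hτ.2⟩ hN'
  have e1 : (∫ x, (cutEOS σ η₁).p (ρ τ x) (θ τ x)) = ∫ x, (EulerEOS.monatomicExcess χ f).p (ρ τ x) (θ τ x) :=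
    integral_congr_ae (Eventually.of_forall fun x => hpB τ hτ x)
  have e2 : (∫ x, (cutEOS σ η₁).p (ρ 0 x) (θ 0 x)) = ∫ x, (EulerEOS.monatomicExcess χ f).p (ρ 0 x) (θ 0 x) :=
    integral_congr_ae (Eventually.of_forall fun x => hpB 0 ⟨le_rfl, hτ0.trans hτ.2⟩ x)
  rw [e1, e2, h]
  -- space–time set integral → iterated integral over `Ioc 0 τ`
  have hc : ContinuousOn (fun z : ℝ × T3 => (pdAt T ρ u θ z).pt (EulerEOS.monatomicExcess χ f)) (Ioo 0 T ×ˢ univ) := by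
    obtain ⟨-, -, hrt, hΘt, -⟩ := (sx_sol_B S).continuousOn_pointData_base
    obtain ⟨cpρ, cpϑ, -⟩ := (sx_sol_B S).continuousOn_pointData_thermo S.2.2.2.2.2.2.2.1
    simp only [StrongPointData.pt]
    exact (cpρ.mul hrt).add (cpϑ.mul hΘt)
  have hmeasS : MeasurableSet (Ioo (0 : ℝ) τ ×ˢ (univ : Set T3)) := measurableSet_Ioo.prod MeasurableSet.univ
  have hSsub : Ioo (0 : ℝ) τ ×ˢ (univ : Set T3) ⊆ Ioo 0 T ×ˢ univ :=
    prod_mono (Ioo_subset_Ioo_right hτ.2.le) subset_rfl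
  have hint : IntegrableOn (fun z : ℝ × T3 => (pdAt T ρ u θ z).pt (EulerEOS.monatomicExcess χ f))
      (Ioo 0 τ ×ˢ univ) volume := by
    refine IntegrableOn.of_bound ?_ ((hc.mono hSsub).aestronglyMeasurable hmeasS) Np ?_
    · rw [Measure.volume_eq_prod, Measure.prod_prod]
      exact ENNReal.mul_lt_top measure_Ioo_lt_top (measure_lt_top _ _)
    · rw [ae_restrict_iff' hmeasS]
      exact Eventually.of_forall fun z hz => by
        rw [Real.norm_eq_abs]; exact hN' z.1 ⟨hz.1.1.le, hz.1.2.le⟩ z.2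
  rw [Measure.volume_eq_prod, setIntegral_prod _ (by rw [← Measure.volume_eq_prod]; exact hint)]
  simp only [Measure.restrict_univ]
  rw [setIntegral_congr_set (Ioo_ae_eq_Ioc (α := ℝ))]
  refine setIntegral_congr_fun measurableSet_Ioc fun t ht => ?_
  exact integral_congr_ae (Eventually.of_forall fun x => (hptB t ⟨ht.1.le, ht.2.trans_lt hτ.2⟩ x).symm)

end Strong

end Summit.AtomisticToContinuum.HydrodynamicLimit.Theorems.RES

end
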